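import Summits.ResolutionOfSingularities.ResolutionOfSingularities.Theorems.PAlterationPialtSqueezeLU
import Summits.ResolutionOfSingularities.ResolutionOfSingularities.Theorems.PAlterationPialtPowMemRange
import Summits.ResolutionOfSingularities.ResolutionOfSingularities.Theorems.PAlterationPialtRegularModel
import HarnessLib

/-!
# `Pialt` (crux stmt-ResolutionOfSingularities-0555), line `SketchIdeator2` / Card A: local
# uniformization in characteristic `p` IS local uniformization below HEIGHT-ONE Frobenius
# sandwiches of regular varieties (modulo `Temkin2013`), over every field

Helper file of the line lead (c1, cycle 2), sharpening `Theorems/PAlterationPialtSqueezeLU.lean`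
(`--supports stmt-ResolutionOfSingularities-0555`; it does not close any item).

`PAlterationPialtSqueezeLU.lean` reduced local uniformization in characteristic `p` (hence, with
Zariski–Piltant patching, the summit) to "RRLU": local uniformization of valuations centred on a
normal affine variety `Spec (B ∩ K)` sandwiched between a REGULAR affine variety `Spec B` and its
Frobenius twist, `B^q ⊆ B ∩ K ⊆ B` with `q = pⁿ` ARBITRARY. This file cuts the exponent down to
ONE STEP: it suffices to uniformize below sandwiches with `[Frac B : K] ∈ {1, p}`, i.e.
`Frac B = K(y)` with `y ^ p ∈ K`. By Jacobson's correspondence these are exactly the quotients of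
regular varieties by ONE `p`-closed rational vector field (`K = (Frac B)^D`), the objects of the
route `FoliationDescent` (`FolLU`, `LogCanQuotLU`) — reached here WITHOUT its torsor cruxes
(`TorsorLUPerfect`, `DualSandwich`) and over every field, perfect or not. The hypothesis
"RRLU1 at `p`" is INLINED (no new definition):

> RRLU1_p: for all fields `k ⊆ K ⊆ L` of characteristic `p` with `K/k` finitely generated and
> `L/K` purely inseparable, generated by one `y` with `y ^ p ∈ K`, every finitely generated
> `k`-subalgebra `B ⊆ L` with `Frac B = L` which is a REGULAR ring, and every valuation ring
> `O ⊇ B` of `L`: the valuation ring `O ∩ K` of `K` is locally uniformizable over `k`.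

* `isLocallyUniformizable_comap_of_rrLU1` — THE DESCENT: under RRLU1_p, for every finite purely
  inseparable `L/K` (any degree) a regular finitely generated affine model of `L` inside `O`
  uniformizes `O ∩ K`. Induction on `[L : K]`, peeling from the bottom: pick `y ∈ L ∖ K` with
  `y ^ p ∈ K` (`exists_not_mem_range_pow_mem_range`), uniformize `O ∩ K(y)` by induction
  (`[L : K(y)] < [L : K]`), upgrade to a regular affine model of `K(y)` inside `O ∩ K(y)`
  (`exists_regularModel_of_isLocallyUniformizable`: fields are J-2), and apply RRLU1_p to the
  height-one step `K ⊆ K(y)`.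
* `localUniformizationInChar_of_temkin2013_of_rrLU1` — hence **`Temkin2013 ∧ RRLU1_p ⇒
  LocalUniformizationInChar p`** (Temkin supplies the regular model at the top of a finite purely
  inseparable `L/K`); with the trivial converse `rrLU1_of_localUniformizationInChar`:
  `localUniformizationInChar_iff_rrLU1` — **modulo `Temkin2013`, `LU_p ↔ RRLU1_p`**.
* `resolutionInChar_iff_rrLU1_and_twoModelPatching` — **modulo `Temkin2013`,
  `ResolutionInChar p ↔ RRLU1_p ∧ ProperModel.TwoModelPatching p`** over all fields of
  characteristic `p`; `resolutionOfSingularities_of_temkin2013_rrLU1_twoModelPatching`,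
  `pialt_of_temkin2013_rrLU1_twoModelPatching` — the summit and the crux from the atoms.

Sources: M. Temkin, J. Algebra 373 (2013), Thm. 1.3.2 and Rem. 1.3.5 (ii)–(iii) ("if we know how
to uniformize valuations on `α_p`-torsors…"; here the dual, quotient, form); N. Jacobson,
*Lectures in Abstract Algebra III*, Ch. IV §8 (purely inseparable extensions of exponent one and
restricted Lie algebras of derivations); O. Zariski, Ann. of Math. 41 (1940); O. Piltant, RACSAM
107 (2013), Prop. 5.1.
-/

set_option linter.dupNamespace false -- mandated namespace of this single-conjunct summit

noncomputable section

open CategoryTheory AlgebraicGeometry IsLocalRing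
open Literature.AlgebraicGeometry.Resolution

namespace Summit.ResolutionOfSingularities.ResolutionOfSingularities.Theorems.Pialt.RadiciallyRegular

open Summit.ResolutionOfSingularities.ResolutionOfSingularities.Theses.PAlteration (Pialt Picover)

/-! ## The descent along a finite purely inseparable extension, one height-one step at a time -/

/-- A finite extension of a finitely generated field extension is finitely generated over the
bottom field (essentially-of-finite-type algebras compose). [folklore] -/
theorem intermediateField_fg_top_of_finiteDimensional' {k K L : Type} [Field k] [Field K]
    [Field L] [Algebra k K] [Algebra K L] [Algebra k L] [IsScalarTower k K L]
    [FiniteDimensional K L] (hfg : (⊤ : IntermediateField k K).FG) :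
    (⊤ : IntermediateField k L).FG := by
  haveI : Algebra.EssFiniteType k K := IntermediateField.fg_top_iff.mp hfg
  haveI : Algebra.EssFiniteType K L := inferInstance
  exact IntermediateField.fg_top_iff.mpr (Algebra.EssFiniteType.comp k K L)

/-- **The descent.** Assume RRLU1 at `p` over the ground field `k` (local uniformization below
height-one Frobenius sandwiches of regular affine varieties, see the module docstring). Then for
every FINITE purely inseparable extension `L/K` of finitely generated fields over `k`, every
valuation ring `O` of `L` and every finitely generated `k`-subalgebra `B ⊆ O` with `Frac B = L`
that is a regular ring, the valuation ring `O ∩ K` of `K` is locally uniformizable over `k`.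
Induction on `[L : K]`: if `K = L` this is RRLU1 with `y = 1`; otherwise pick `y ∈ L ∖ K` with
`y ^ p ∈ K` (`exists_not_mem_range_pow_mem_range`), uniformize `O ∩ K(y)` by induction
(`[L : K(y)] < [L : K]` by the tower law), pass to a regular affine model of `K(y)` inside
`O ∩ K(y)` (`exists_regularModel_of_isLocallyUniformizable`), and apply RRLU1 to `K ⊆ K(y)`.
[folklore] -/
theorem isLocallyUniformizable_comap_of_rrLU1 {p : ℕ} [Fact p.Prime] (k : Type) [Field k]
    [CharP k p]
    (h1 : ∀ (K L : Type) [Field K] [Field L] [Algebra k K] [Algebra K L]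
      [Algebra k L] [IsScalarTower k K L], (⊤ : IntermediateField k K).FG →
      IsPurelyInseparable K L →
      (∃ y : L, y ^ p ∈ (algebraMap K L).range ∧ IntermediateField.adjoin K {y} = ⊤) →
      ∀ B : Subalgebra k L, B.FG → IsFractionRing B L → IsRegularRing B →
      ∀ O : ValuationSubring L, B.toSubring ≤ O.toSubring →
        IsLocallyUniformizable k K (O.comap (algebraMap K L))) :
    ∀ (d : ℕ) (K L : Type) [Field K] [Field L] [Algebra k K] [Algebra K L] [Algebra k L]
      [IsScalarTower k K L] [FiniteDimensional K L] [IsPurelyInseparable K L],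
      Module.finrank K L ≤ d → (⊤ : IntermediateField k K).FG →
      ∀ (O : ValuationSubring L) (B : Subalgebra k L), B.FG → IsFractionRing B L →
        IsRegularRing B → B.toSubring ≤ O.toSubring →
        IsLocallyUniformizable k K (O.comap (algebraMap K L)) := by
  intro d
  induction d with
  | zero =>
    intro K L _ _ _ _ _ _ _ _ hd
    exact absurd hd (not_le.mpr Module.finrank_pos)
  | succ d ih =>
    intro K L _ _ _ _ _ _ _ _ hd hfg O B hBfg hBfr hBreg hBO
    by_cases hsurj : Function.Surjective (algebraMap K L)
    · -- `K = L`: RRLU1 with `y = 1`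
      refine h1 K L hfg ‹_› ⟨1, ⟨1, by rw [one_pow, map_one]⟩, ?_⟩ B hBfg hBfr hBreg O hBO
      refine eq_top_iff.mpr fun x _ => ?_
      obtain ⟨a, rfl⟩ := hsurj x
      exact IntermediateField.algebraMap_mem _ a
    · -- a height-one step `K ⊊ K(y) ⊆ L`
      haveI : CharP K p := charP_of_injective_algebraMap (algebraMap k K).injective p
      obtain ⟨y, hyK, hyp⟩ := exists_not_mem_range_pow_mem_range p K L hsurj
      set K₁ : IntermediateField K L := IntermediateField.adjoin K {y} with hK₁
      haveI : FiniteDimensional (↥K₁) L := Module.Finite.of_restrictScalars_finite K _ _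
      haveI : IsScalarTower k (↥K₁) L := IsScalarTower.of_algebraMap_eq fun _ => rfl
      -- `[L : K(y)] ≤ d`
      have hK₁ne : K₁ ≠ ⊥ := by
        intro h
        apply hyK
        have hy : y ∈ K₁ := IntermediateField.mem_adjoin_simple_self K y
        rw [h, IntermediateField.mem_bot] at hy
        obtain ⟨a, ha⟩ := hy
        exact ⟨a, ha⟩
      have h2 : 2 ≤ Module.finrank K ↥K₁ := by
        have hne1 : Module.finrank K ↥K₁ ≠ 1 := fun h =>
          hK₁ne (IntermediateField.finrank_eq_one_iff.mp h)
        have hpos : 0 < Module.finrank K ↥K₁ := Module.finrank_pos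
        omega
      have htower : Module.finrank K ↥K₁ * Module.finrank (↥K₁) L = Module.finrank K L :=
        Module.finrank_mul_finrank K (↥K₁) L
      have hd₁ : Module.finrank (↥K₁) L ≤ d := by
        have hposL : 0 < Module.finrank (↥K₁) L := Module.finrank_pos
        nlinarith [htower, h2, hd, hposL]
      -- induction: `O ∩ K(y)` is locally uniformizable
      have hfg₁ : (⊤ : IntermediateField k ↥K₁).FG :=
        intermediateField_fg_top_of_finiteDimensional' hfg
      have hLU₁ : IsLocallyUniformizable k (↥K₁) (O.comap (algebraMap (↥K₁) L)) :=
        ih (↥K₁) L hd₁ hfg₁ O B hBfg hBfr hBreg hBO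
      -- a regular affine model of `K(y)` inside `O ∩ K(y)`
      obtain ⟨B₁, hB₁O, hB₁fg, hB₁fr, hB₁reg⟩ :=
        exists_regularModel_of_isLocallyUniformizable k (↥K₁) _ hLU₁
      -- RRLU1 at the height-one step `K ⊆ K(y)`
      have hy₁ : ∃ y₁ : ↥K₁, y₁ ^ p ∈ (algebraMap K ↥K₁).range ∧
          IntermediateField.adjoin K {y₁} = ⊤ := by
        refine ⟨⟨y, IntermediateField.mem_adjoin_simple_self K y⟩, ?_, ?_⟩
        · obtain ⟨a, ha⟩ := hyp
          refine ⟨a, Subtype.ext ?_⟩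
          rw [IntermediateField.coe_algebraMap_apply, ha]
          rfl
        · apply IntermediateField.lift_injective
          rw [IntermediateField.lift_adjoin_simple, IntermediateField.lift_top]
      have key := h1 K (↥K₁) hfg inferInstance hy₁ B₁ hB₁fg hB₁fr hB₁reg
        (O.comap (algebraMap (↥K₁) L)) hB₁O
      rw [ValuationSubring.comap_comap, ← IsScalarTower.algebraMap_eq] at key
      exact key

/-! ## `LU_p ↔ RRLU1_p` modulo `Temkin2013` -/

/-- **Local uniformization in characteristic `p` from `Temkin2013` and RRLU1_p** (every field of
characteristic `p`): Temkin's inseparable local uniformization gives a finite purely inseparable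
`L/K` on which the valuation is uniformized, hence (`exists_regularModel_of_isLocallyUniformizable`)
a regular finitely generated affine model of `L` inside the valuation ring; the descent
`isLocallyUniformizable_comap_of_rrLU1` brings local uniformization down to `K`.
[cite: Temkin2013, Thm. 1.3.2 and Rem. 1.3.5 (ii)–(iii)] -/
theorem localUniformizationInChar_of_temkin2013_of_rrLU1 (hT : Temkin2013.{0}) {p : ℕ}
    [Fact p.Prime]
    (h1 : ∀ (k K L : Type) [Field k] [CharP k p] [Field K] [Field L] [Algebra k K] [Algebra K L]
      [Algebra k L] [IsScalarTower k K L], (⊤ : IntermediateField k K).FG →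
      IsPurelyInseparable K L →
      (∃ y : L, y ^ p ∈ (algebraMap K L).range ∧ IntermediateField.adjoin K {y} = ⊤) →
      ∀ B : Subalgebra k L, B.FG → IsFractionRing B L → IsRegularRing B →
      ∀ O : ValuationSubring L, B.toSubring ≤ O.toSubring →
        IsLocallyUniformizable k K (O.comap (algebraMap K L))) :
    LocalUniformizationInChar.{0} p := by
  intro k K _ _ _ _ hfg O hO
  obtain ⟨L, _, _, _, _, hfd, hpi, O', hO'O, hLU'⟩ := hT k K hfg O hO
  haveI := hfd
  haveI := hpi
  obtain ⟨B, hBO', hBfg, hBfr, hBreg⟩ := exists_regularModel_of_isLocallyUniformizable k L O' hLU'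
  have key := isLocallyUniformizable_comap_of_rrLU1 k (fun K' L' _ _ _ _ _ _ => h1 k K' L')
    (Module.finrank K L) K L le_rfl hfg O' B hBfg hBfr hBreg hBO'
  rwa [hO'O] at key

/-- **Conversely, local uniformization in characteristic `p` gives RRLU1_p** (it uniformizes
`O ∩ K` outright, `K/k` being finitely generated by hypothesis). [folklore] -/
theorem rrLU1_of_localUniformizationInChar {p : ℕ} (h : LocalUniformizationInChar.{0} p)
    (k K L : Type) [Field k] [CharP k p] [Field K] [Field L] [Algebra k K] [Algebra K L]
    [Algebra k L] [IsScalarTower k K L] (hfg : (⊤ : IntermediateField k K).FG)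
    (_hpi : IsPurelyInseparable K L)
    (_hy : ∃ y : L, y ^ p ∈ (algebraMap K L).range ∧ IntermediateField.adjoin K {y} = ⊤)
    (B : Subalgebra k L) (_hBfg : B.FG) (_hBfr : IsFractionRing B L) (_hBreg : IsRegularRing B)
    (O : ValuationSubring L) (hBO : B.toSubring ≤ O.toSubring) :
    IsLocallyUniformizable k K (O.comap (algebraMap K L)) := by
  refine h k K hfg (O.comap (algebraMap K L)) fun c => ?_
  change algebraMap K L (algebraMap k K c) ∈ O
  rw [← IsScalarTower.algebraMap_apply]
  exact hBO (B.algebraMap_mem c)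

/-- **Modulo `Temkin2013`, Zariski local uniformization in characteristic `p` is EXACTLY local
uniformization below height-one Frobenius sandwiches of regular affine varieties** — the
"inseparable case" in its minimal, exponent-one form (quotients of regular varieties by one
`p`-closed rational vector field), over every field of characteristic `p`.
[cite: Temkin2013, Thm. 1.3.2 and Rem. 1.3.5 (ii)–(iii)] -/
theorem localUniformizationInChar_iff_rrLU1 (hT : Temkin2013.{0}) (p : ℕ) [Fact p.Prime] :
    LocalUniformizationInChar.{0} p ↔
      ∀ (k K L : Type) [Field k] [CharP k p] [Field K] [Field L] [Algebra k K] [Algebra K L]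
        [Algebra k L] [IsScalarTower k K L], (⊤ : IntermediateField k K).FG →
        IsPurelyInseparable K L →
        (∃ y : L, y ^ p ∈ (algebraMap K L).range ∧ IntermediateField.adjoin K {y} = ⊤) →
        ∀ B : Subalgebra k L, B.FG → IsFractionRing B L → IsRegularRing B →
        ∀ O : ValuationSubring L, B.toSubring ≤ O.toSubring →
          IsLocallyUniformizable k K (O.comap (algebraMap K L)) :=
  ⟨fun h k K L _ _ _ _ _ _ _ _ hfg hpi hy B hBfg hBfr hBreg O hBO =>
      rrLU1_of_localUniformizationInChar h k K L hfg hpi hy B hBfg hBfr hBreg O hBO,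
    fun h => localUniformizationInChar_of_temkin2013_of_rrLU1 hT h⟩

/-! ## Resolution in characteristic `p`, the summit and the crux from `Temkin2013 ∧ RRLU1 ∧ TMP` -/

/-- **Modulo `Temkin2013`, `ResolutionInChar p ↔ RRLU1_p ∧ TwoModelPatching p`** over all fields
of characteristic `p`: resolution of singularities in characteristic `p` splits EXACTLY into
local uniformization below height-one Frobenius sandwiches of regular varieties and
Zariski–Piltant two-model patching (`resolutionInChar_iff_twoModelPatching_and_lu` +
`localUniformizationInChar_iff_rrLU1`). [cite: Piltant2013, Prop. 5.1 (P = P_reg)] -/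
theorem resolutionInChar_iff_rrLU1_and_twoModelPatching (hT : Temkin2013.{0}) (p : ℕ)
    [Fact p.Prime] :
    ResolutionInChar.{0} p ↔
      (∀ (k K L : Type) [Field k] [CharP k p] [Field K] [Field L] [Algebra k K] [Algebra K L]
        [Algebra k L] [IsScalarTower k K L], (⊤ : IntermediateField k K).FG →
        IsPurelyInseparable K L →
        (∃ y : L, y ^ p ∈ (algebraMap K L).range ∧ IntermediateField.adjoin K {y} = ⊤) →
        ∀ B : Subalgebra k L, B.FG → IsFractionRing B L → IsRegularRing B →
        ∀ O : ValuationSubring L, B.toSubring ≤ O.toSubring →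
          IsLocallyUniformizable k K (O.comap (algebraMap K L))) ∧
      ProperModel.TwoModelPatching.{0} p := by
  rw [resolutionInChar_iff_twoModelPatching_and_lu, localUniformizationInChar_iff_rrLU1 hT p]
  exact and_comm

/-- **The summit from `Temkin2013`, RRLU1 in every prime characteristic and two-model patching
in every prime characteristic** (all fields). [folklore] -/
theorem resolutionOfSingularities_of_temkin2013_rrLU1_twoModelPatching (hT : Temkin2013.{0})
    (h1 : ∀ p : ℕ, p.Prime → ∀ (k K L : Type) [Field k] [CharP k p] [Field K] [Field L]
      [Algebra k K] [Algebra K L] [Algebra k L] [IsScalarTower k K L],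
      (⊤ : IntermediateField k K).FG → IsPurelyInseparable K L →
      (∃ y : L, y ^ p ∈ (algebraMap K L).range ∧ IntermediateField.adjoin K {y} = ⊤) →
      ∀ B : Subalgebra k L, B.FG → IsFractionRing B L → IsRegularRing B →
      ∀ O : ValuationSubring L, B.toSubring ≤ O.toSubring →
        IsLocallyUniformizable k K (O.comap (algebraMap K L)))
    (hZ : ∀ p : ℕ, p.Prime → ProperModel.TwoModelPatching.{0} p) :
    _root_.ResolutionOfSingularities := by
  intro p hp
  haveI : Fact p.Prime := ⟨hp⟩
  exact (resolutionInChar_iff_rrLU1_and_twoModelPatching hT p).mpr ⟨h1 p hp, hZ p hp⟩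

/-- **The crux `Pialt` from `Temkin2013`, RRLU1 and two-model patching** (through the summit and
the route's sandwich `resolutionOfSingularities_iff_pialt_and_picover`). [folklore] -/
theorem pialt_of_temkin2013_rrLU1_twoModelPatching (hT : Temkin2013.{0})
    (h1 : ∀ p : ℕ, p.Prime → ∀ (k K L : Type) [Field k] [CharP k p] [Field K] [Field L]
      [Algebra k K] [Algebra K L] [Algebra k L] [IsScalarTower k K L],
      (⊤ : IntermediateField k K).FG → IsPurelyInseparable K L →
      (∃ y : L, y ^ p ∈ (algebraMap K L).range ∧ IntermediateField.adjoin K {y} = ⊤) →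
      ∀ B : Subalgebra k L, B.FG → IsFractionRing B L → IsRegularRing B →
      ∀ O : ValuationSubring L, B.toSubring ≤ O.toSubring →
        IsLocallyUniformizable k K (O.comap (algebraMap K L)))
    (hZ : ∀ p : ℕ, p.Prime → ProperModel.TwoModelPatching.{0} p) : Pialt :=
  (resolutionOfSingularities_iff_pialt_and_picover.mp
    (resolutionOfSingularities_of_temkin2013_rrLU1_twoModelPatching hT h1 hZ)).1

/-! ## Field by field (appended, lead c1): the descent consumes RRLU1 only over the given ground field -/

/-- **Local uniformization over ONE ground field `k` from `Temkin2013` and RRLU1 over that `k`.**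
The descent `isLocallyUniformizable_comap_of_rrLU1` uses the hypothesis only for towers over the
fixed `k`; so, e.g., RRLU1 over PERFECT fields (the range of route `FoliationDescent`'s `FolLU` /
`LogCanQuotLU`) already gives local uniformization of every finitely generated `K/k` with `k`
perfect. [cite: Temkin2013, Thm. 1.3.2 and Rem. 1.3.5 (ii)–(iii)] -/
theorem isLocallyUniformizable_of_temkin2013_of_rrLU1_at (hT : Temkin2013.{0}) {p : ℕ}
    [Fact p.Prime] (k : Type) [Field k] [CharP k p]
    (h1 : ∀ (K L : Type) [Field K] [Field L] [Algebra k K] [Algebra K L]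
      [Algebra k L] [IsScalarTower k K L], (⊤ : IntermediateField k K).FG →
      IsPurelyInseparable K L →
      (∃ y : L, y ^ p ∈ (algebraMap K L).range ∧ IntermediateField.adjoin K {y} = ⊤) →
      ∀ B : Subalgebra k L, B.FG → IsFractionRing B L → IsRegularRing B →
      ∀ O : ValuationSubring L, B.toSubring ≤ O.toSubring →
        IsLocallyUniformizable k K (O.comap (algebraMap K L)))
    (K : Type) [Field K] [Algebra k K] (hfg : (⊤ : IntermediateField k K).FG)
    (O : ValuationSubring K) (hO : ∀ c : k, algebraMap k K c ∈ O) :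
    IsLocallyUniformizable k K O := by
  obtain ⟨L, _, _, _, _, hfd, hpi, O', hO'O, hLU'⟩ := hT k K hfg O hO
  haveI := hfd
  haveI := hpi
  obtain ⟨B, hBO', hBfg, hBfr, hBreg⟩ := exists_regularModel_of_isLocallyUniformizable k L O' hLU'
  have key := isLocallyUniformizable_comap_of_rrLU1 k h1 (Module.finrank K L) K L le_rfl hfg
    O' B hBfg hBfr hBreg hBO'
  rwa [hO'O] at key

/-- **Resolution over ONE ground field `k` from `Temkin2013`, RRLU1 over `k` and two-model
patching over `k`** (Zariski–Piltant engine `resolutionOverUpToDim_of_properPatching_of_lu`, field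
by field). [cite: Piltant2013, Prop. 5.1 and Cor. 5.7] -/
theorem hasResolution_of_temkin2013_of_rrLU1_at_of_twoModelPatching_at (hT : Temkin2013.{0})
    {p : ℕ} [Fact p.Prime] (k : Type) [Field k] [CharP k p]
    (h1 : ∀ (K L : Type) [Field K] [Field L] [Algebra k K] [Algebra K L]
      [Algebra k L] [IsScalarTower k K L], (⊤ : IntermediateField k K).FG →
      IsPurelyInseparable K L →
      (∃ y : L, y ^ p ∈ (algebraMap K L).range ∧ IntermediateField.adjoin K {y} = ⊤) →
      ∀ B : Subalgebra k L, B.FG → IsFractionRing B L → IsRegularRing B →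
      ∀ O : ValuationSubring L, B.toSubring ≤ O.toSubring →
        IsLocallyUniformizable k K (O.comap (algebraMap K L)))
    (hZ : ∀ (K : Type) [Field K] [Algebra k K] [Algebra.EssFiniteType k K],
      ∀ M₁ M₂ : ProperModel k K,
        ∃ (N : ProperModel k K) (φ₁ : N.Hom M₁) (φ₂ : N.Hom M₂), φ₁.RegLe ∧ φ₂.RegLe)
    (X : Scheme.{0}) (f : X ⟶ Spec (.of k)) [IsSeparated f] [LocallyOfFiniteType f]
    [QuasiCompact f] [IsReduced X] : Scheme.HasResolution X := by
  haveI : CompactSpace X := QuasiCompact.compactSpace_of_compactSpace f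
  obtain ⟨d, hd⟩ := exists_topologicalKrullDim_le_of_locallyOfFiniteType f
  exact resolutionOverUpToDim_of_properPatching_of_lu hZ
    (fun K _ _ hKfg O hO => isLocallyUniformizable_of_temkin2013_of_rrLU1_at hT k h1 K hKfg O hO)
    d X f ‹_› ‹_› ‹_› ‹_› hd

end Summit.ResolutionOfSingularities.ResolutionOfSingularities.Theorems.Pialt.RadiciallyRegular

end
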